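import Mathlib
import Summits.ResolutionOfSingularities.ResolutionOfSingularities.Theorems.RadicialJungCleanModelsCleanProp44NearLineNoTangent
import Summits.ResolutionOfSingularities.ResolutionOfSingularities.Theorems.RadicialJungCleanModelsCleanProp44NearLineScheme
import Literature.AlgebraicGeometry.Resolution.BlowupStalkCharts
import HarnessLib

/-!
# Route `RadicialJung`, crux `CleanModels` (stmt-ResolutionOfSingularities-15917), line `Sketch` rev 35, stub 6 `stub_cleanProp44` (X44c):
# CLEAN-PERMISSIBILITY OF NEAR LINES, VIII — no tangency at the points of an actual point blowing up (scheme level)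

Seat decomp-res-hand-2 g18 (structural hand); scheme-level packaging of ✓ `side_trichotomy_nearLine` (`…CleanProp44NearLineNoTangent.lean`)
through ✓ `IsBlowup.exists_reesChart_stalk`, in the currency of the classification ✓ `cleanPermissibleAt_exceptionalCurve_or_obstruction`:

* `side_trichotomy_nearLine_reesChart` — the Rees chart `(R[𝔪t])_{(t_j t)}` presented by a ring map `χ`.
* `side_trichotomy_nearLine_of_isBlowup` — `τ : X' → X` a blowing up along `J` with `J_x = 𝔪_x` at `x = τ x'` (a POINT centre, locally),
  `t` a regular system of parameters of `𝒪_{X,x}`, a near line `N = (e', y')` at `x'` in the shape of [CoP1] Lemma 4.3 (5)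
  (`(e') = 𝔪_x 𝒪_{X',x'}`, `τ^♯ t_{j₀} = e' · y'`, `y' ∈ 𝔪_{x'}`, `(e', y', z')` a regular system of parameters of `𝒪_{X',x'}`): for EVERY
  `t' ∈ 𝔪_x` (a clean side of ANY regular system of parameters at `x`) the transform reads `τ^♯ t' = e' · s` with `s` a UNIT (the side does not
  pass through `x'`), or `(e', y', s) = 𝔪_{x'}` (TRANSVERSAL), or `s ∈ N` (the side CONTAINS the near line) — never tangent.

So on a near line the residue of the classification is «corners met in a non-axis direction ∨ births» only.  Honest framing: OURS; a TOOL for the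
(R1ᵐⁱⁿ)/(R3ᵐⁱⁿ′) provers.  Nothing here proves X44c, any case of `CleanModels`, or resolution of singularities in characteristic `p`.
Setting only: [cite: CossartPiltant2008, Lemma 4.3 (5)] [cite: StacksProject, Tag 0804] [cite: GortzWedhorn2020, Prop. 13.91].
-/

noncomputable section

set_option linter.dupNamespace false -- mandated namespace of this single-conjunct summit

open IsLocalRing CategoryTheory AlgebraicGeometry
open Literature.AlgebraicGeometry.Resolution Literature.AlgebraicGeometry.Motives

namespace Summit.ResolutionOfSingularities.ResolutionOfSingularities.Theorems.RadicialJung.CleanModels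

universe u

/-! ## §1 Rees chart -/

section ReesChart

variable {R : Type u} [CommRing R] [IsRegularLocalRing R] {d : ℕ} (t : Fin d → R) (j : Fin d)
  (hspan : Ideal.span (Set.range t) = maximalIdeal R) (hdim : ringKrullDim R = (d : WithBot ℕ∞))
  (𝔴 : Ideal (chartRing t j)) [𝔴.IsPrime] (h𝔴 : 𝔴.comap (chartBase t j) = maximalIdeal R)
  (L : Type u) [CommRing L] [IsLocalRing L] (χ : chartRing t j →+* L)
  (hloc : @IsLocalization.AtPrime _ _ L _ χ.toAlgebra 𝔴 _)

include hspan hdim h𝔴 hloc in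
/-- **No tangency, Rees chart** (`side_trichotomy_nearLine` for `A = (R[𝔪t])_{(t_j t)}`, `ψ = chartBase`, `u_i = chartGen`, `L = A_𝔴`
presented by `χ`). [cite: CossartPiltant2008, Lemma 4.3 (5)] [cite: StacksProject, Tag 0804] -/
theorem side_trichotomy_nearLine_reesChart (j₀ : Fin d) (hj₀ : chartGen t j j₀ ∈ 𝔴) {t' : R} (ht' : t' ∈ maximalIdeal R) {z' : L}
    (hzz : Ideal.span ({χ (chartBase t j (t j)), χ (chartGen t j j₀), z'} : Set L) = maximalIdeal L) :
    ∃ s : chartRing t j, chartBase t j t' = chartBase t j (t j) * s ∧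
      (χ s ∉ maximalIdeal L ∨ Ideal.span ({χ (chartBase t j (t j)), χ (chartGen t j j₀), χ s} : Set L) = maximalIdeal L ∨
        s ∈ (Ideal.span {chartBase t j (t j), chartGen t j j₀} : Ideal (chartRing t j))) := by
  letI := χ.toAlgebra
  haveI := hloc
  obtain ⟨m, -, hm⟩ := exists_side_eq_mul t j hspan (chartBase t j) (chartGen t j) (reesChartBase_apply_eq_mul_chartGen t j) ht'
  refine ⟨_, hm, ?_⟩
  by_cases hs : χ (∑ k, chartBase t j (m k) * chartGen t j k) ∈ maximalIdeal L
  · right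
    exact side_trichotomy_nearLine t j hspan (chartBase t j) (chartGen t j) (reesChartBase_apply_eq_mul_chartGen t j)
      (reesChartBase_mem_nonZeroDivisors _ _)
      (chartQuotEquiv t j (isQuasiRegular_centre t Fin.elim0 (span_range_append_elim0 t hspan) (spanFinrank_eq_add_zero hdim)))
      (chartQuotMap_C t j) (chartQuotMap_X t j) 𝔴 h𝔴 L j₀ hj₀ m hzz hs
  · exact Or.inl hs

end ReesChart

/-! ## §2 Scheme level -/

section Scheme

variable {X X' : Scheme.{u}} {τ : X' ⟶ X} {J : X.IdealSheafData}

/-- Spans of triples are insensitive to replacing the first two generators by associates. [folklore] -/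
private theorem span_triple_congr {S : Type u} [CommRing S] {a a' b b' c : S} (ha : Ideal.span ({a} : Set S) = Ideal.span {a'})
    (hb : Ideal.span ({b} : Set S) = Ideal.span {b'}) : Ideal.span ({a, b, c} : Set S) = Ideal.span {a', b', c} := by
  rw [Ideal.span_insert, Ideal.span_insert, ha, hb, ← Ideal.span_insert, ← Ideal.span_insert]

/-- Spans of pairs are insensitive to replacing the generators by associates. [folklore] -/
private theorem span_pair_congr {S : Type u} [CommRing S] {a a' b b' : S} (ha : Ideal.span ({a} : Set S) = Ideal.span {a'})
    (hb : Ideal.span ({b} : Set S) = Ideal.span {b'}) : Ideal.span ({a, b} : Set S) = Ideal.span {a', b'} := by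
  rw [Ideal.span_insert, ha, hb, ← Ideal.span_insert]

set_option maxHeartbeats 1600000 in
-- stalk-level bookkeeping through the Rees chart presentation
/-- **NO TANGENCY at the points of a point blowing up.**  Let `τ : X' → X` be a blowing up along `J` with `J_x = 𝔪_x` at `x = τ x'`, `t` a
regular system of parameters of the regular `𝒪_{X,x}` (`d = dim`), and let `x'` lie on the NEAR LINE of the coordinate `t_{j₀}`: `(e') = 𝔪_x 𝒪_{X',x'}`,
`τ^♯ t_{j₀} = e' · y'` with `y' ∈ 𝔪_{x'}`, and `(e', y', z')` a regular system of parameters of `𝒪_{X',x'}` ([CoP1] Lemma 4.3 (5),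
✓ `CP2008Prop44.stalkIdeal_vanishingIdeal_closure_eq_span_pair_of_adapted`).  Then for every `t' ∈ 𝔪_x`: `τ^♯ t' = e' · s` where `s` is a unit,
or `(e', y', s) = 𝔪_{x'}`, or `s ∈ (e', y')` — a clean side through `x'` is transversal to the near line or contains it, NEVER TANGENT.
[cite: CossartPiltant2008, Lemma 4.3 (5)] [cite: StacksProject, Tag 0804] [cite: GortzWedhorn2020, Prop. 13.91] -/
theorem side_trichotomy_nearLine_of_isBlowup (hτ : IsBlowup τ J) (x' : X') (hR : IsRegularLocalRing (X.presheaf.stalk (τ x')))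
    {d : ℕ} (t : Fin d → X.presheaf.stalk (τ x')) (hspan : Ideal.span (Set.range t) = maximalIdeal (X.presheaf.stalk (τ x')))
    (hdim : ringKrullDim (X.presheaf.stalk (τ x')) = (d : WithBot ℕ∞)) (hJ : stalkIdeal J (τ x') = maximalIdeal (X.presheaf.stalk (τ x')))
    (j₀ : Fin d) {e' y' z' : X'.presheaf.stalk x'}
    (he' : Ideal.span {e'} = (maximalIdeal (X.presheaf.stalk (τ x'))).map (τ.stalkMap x').hom)
    (hy' : (τ.stalkMap x').hom (t j₀) = e' * y') (hy'm : y' ∈ maximalIdeal (X'.presheaf.stalk x'))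
    (hzz : Ideal.span ({e', y', z'} : Set (X'.presheaf.stalk x')) = maximalIdeal (X'.presheaf.stalk x'))
    {t' : X.presheaf.stalk (τ x')} (ht' : t' ∈ maximalIdeal (X.presheaf.stalk (τ x'))) :
    ∃ s : X'.presheaf.stalk x', (τ.stalkMap x').hom t' = e' * s ∧
      (IsUnit s ∨ Ideal.span ({e', y', s} : Set (X'.presheaf.stalk x')) = maximalIdeal (X'.presheaf.stalk x') ∨
        s ∈ Ideal.span ({e', y'} : Set (X'.presheaf.stalk x'))) := by
  classical
  haveI := hR
  obtain ⟨j, 𝔴, χ, hχ, hloc, hcomap⟩ := hτ.exists_reesChart_stalk x' t (hspan.trans hJ.symm)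
  letI := χ.toAlgebra
  haveI := hloc
  haveI : IsNoetherianRing (chartRing t j) := isNoetherianRing_blowupChart t j
  -- `𝒪_{X',x'}` is a regular local ring, hence a domain
  have hL : IsRegularLocalRing (X'.presheaf.stalk x') :=
    isRegularLocalRing_chart t j Fin.elim0 (span_range_append_elim0 t hspan) (spanFinrank_eq_add_zero hdim) (X'.presheaf.stalk x')
      (chartBase t j) (chartGen t j) (reesChartBase_mem_nonZeroDivisors _ _)
      (chartQuotEquiv t j (isQuasiRegular_centre t Fin.elim0 (span_range_append_elim0 t hspan) (spanFinrank_eq_add_zero hdim)))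
      (chartQuotMap_C t j) (chartQuotMap_X t j) 𝔴.asIdeal hcomap
  haveI := isDomain_of_isRegularLocalRing (X'.presheaf.stalk x')
  have hmem : ∀ z : chartRing t j, χ z ∈ maximalIdeal (X'.presheaf.stalk x') ↔ z ∈ 𝔴.asIdeal := fun z =>
    IsLocalization.AtPrime.to_map_mem_maximal_iff (X'.presheaf.stalk x') 𝔴.asIdeal z
  -- the exceptional generator of the chart, `e = χ(t_j)`, and the fractions
  have hrel : ∀ k, (τ.stalkMap x').hom (t k) = χ (chartBase t j (t j)) * χ (chartGen t j k) := fun k => by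
    rw [← hχ, ← map_mul, reesChartBase_apply_eq_mul_chartGen t j k]
  have hE : Ideal.span {χ (chartBase t j (t j))} = (maximalIdeal (X.presheaf.stalk (τ x'))).map (τ.stalkMap x').hom := by
    rw [← hspan, hχ]
    refine span_singleton_eq_map_span_of_rel _ t j (fun k => χ (chartGen t j k)) fun k => ?_
    rw [hrel k, hχ]
  obtain ⟨v, hv⟩ : Associated e' (χ (chartBase t j (t j))) := Ideal.span_singleton_eq_span_singleton.mp (he'.trans hE.symm)
  have he0 : χ (chartBase t j (t j)) ≠ 0 := by
    intro h0
    have h2 : algebraMap (chartRing t j) (X'.presheaf.stalk x') (chartBase t j (t j)) ∈ nonZeroDivisors (X'.presheaf.stalk x') :=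
      IsLocalization.nonZeroDivisors_le_comap 𝔴.asIdeal.primeCompl (X'.presheaf.stalk x') (reesChartBase_mem_nonZeroDivisors _ _)
    have h3 : χ (chartBase t j (t j)) ∈ nonZeroDivisors (X'.presheaf.stalk x') := h2
    rw [h0] at h3
    exact zero_notMem_nonZeroDivisors h3
  have he'0 : e' ≠ 0 := left_ne_zero_of_mul (hv.symm ▸ he0)
  -- `y' = v · uf_{j₀}`, so `uf_{j₀} ∈ 𝔴`
  have hy'v : y' = ↑v * χ (chartGen t j j₀) := by
    apply mul_left_cancel₀ he'0
    rw [← hy', ← mul_assoc, hv, hrel j₀]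
  have hj₀ : chartGen t j j₀ ∈ 𝔴.asIdeal := by
    rw [← hmem]
    have h1 : χ (chartGen t j j₀) = ↑v⁻¹ * y' := by rw [hy'v, ← mul_assoc, Units.inv_mul, one_mul]
    rw [h1]
    exact Ideal.mul_mem_left _ _ hy'm
  -- spans in the chart currency
  have hspe : Ideal.span ({e'} : Set (X'.presheaf.stalk x')) = Ideal.span {χ (chartBase t j (t j))} := he'.trans hE.symm
  have hspy : Ideal.span ({y'} : Set (X'.presheaf.stalk x')) = Ideal.span {χ (chartGen t j j₀)} := by
    rw [hy'v, Ideal.span_singleton_mul_left_unit (Units.isUnit v)]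
  have hzz' : Ideal.span ({χ (chartBase t j (t j)), χ (chartGen t j j₀), z'} : Set (X'.presheaf.stalk x')) =
      maximalIdeal (X'.presheaf.stalk x') := by
    rw [← span_triple_congr hspe hspy, hzz]
  obtain ⟨s₀, hs₀, htri⟩ := side_trichotomy_nearLine_reesChart t j hspan hdim 𝔴.asIdeal hcomap (X'.presheaf.stalk x') χ hloc j₀ hj₀
    ht' hzz'
  -- the side in the `e'`-currency: `s = v · χ s₀`
  refine ⟨↑v * χ s₀, ?_, ?_⟩
  · rw [← hχ, hs₀, map_mul, ← hv, mul_assoc]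
  have hsps : Ideal.span ({↑v * χ s₀} : Set (X'.presheaf.stalk x')) = Ideal.span {χ s₀} :=
    Ideal.span_singleton_mul_left_unit (Units.isUnit v) _
  rcases htri with hunit | htr | hmemN
  · exact Or.inl ((Units.isUnit v).mul (IsLocalRing.notMem_maximalIdeal.mp hunit))
  · refine Or.inr (Or.inl ?_)
    rw [span_triple_congr hspe hspy]
    have h3 : Ideal.span ({χ (chartBase t j (t j)), χ (chartGen t j j₀), ↑v * χ s₀} : Set (X'.presheaf.stalk x')) =
        Ideal.span {χ (chartBase t j (t j)), χ (chartGen t j j₀), χ s₀} := by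
      rw [Ideal.span_insert, Ideal.span_insert, hsps, ← Ideal.span_insert, ← Ideal.span_insert]
    rw [h3, htr]
  · refine Or.inr (Or.inr ?_)
    rw [span_pair_congr hspe hspy]
    have h4 : χ s₀ ∈ (Ideal.span {chartBase t j (t j), chartGen t j j₀} : Ideal (chartRing t j)).map χ := Ideal.mem_map_of_mem χ hmemN
    rw [Ideal.map_span, Set.image_pair] at h4
    exact Ideal.mul_mem_left _ _ h4

end Scheme

end Summit.ResolutionOfSingularities.ResolutionOfSingularities.Theorems.RadicialJung.CleanModels

end
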